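import Mathlib
import Summits.ValiantsHypothesis.ValiantsHypothesis.Theorems.KPlusLogSqLawWeakLiftingTowerGraftArgumentPrinciple

/-!
# Tower graft line — ROUCHÉ IN ONE DISC: zeros of the residual off `A·E = 0` vs distinct roots of `A·E`

Mechanism file for the line `Cruxes/WeakLifting/Lines/tower_graft.lean` (crux `WeakLifting` = stmt-ValiantsHypothesis-19561,
memo `tower_graft-S5.md` §3 T1; this seat's memo `HOME/val-sym-lift-p1/g20/memo/T1-CORNER-liftp1g20.md` §5 (c)).  NO stub is claimed.
§1 The Rolle–Schur residual `W = X(A′E − AE′) − d·AE` vanishes to order `≥ m − 1` at a root of `A·E` of multiplicity `m`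
   (`pow_sub_one_dvd_residual`, `rootMultiplicity_residual_ge`; any field).
§2 ONE-DISC COUNT (`card_real_zeros_residual_le_in_disc`): if on a circle the complexified residual satisfies the Rouché inequality
   `‖W + D·AE‖ < ‖D·AE‖`, then the real zeros of `W` in the disc off `A·E = 0` number at most the DISTINCT complex roots of `A·E`
   in the disc (Rouché `card_roots_filter_ball_eq_of_norm_lt` + the multiplicity bookkeeping `Σ m − Σ (m − 1)`).
HONEST FRAMING: classical analysis; nothing on S4/S4b/S5, TowerB, `WeakLifting`, B, 18050 or `VP ≠ VNP`.  Def-free.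
Seat: prover val-sym-lift-p1 g20, `--supports stmt-ValiantsHypothesis-19561`.
-/

-- `Summit.ValiantsHypothesis.ValiantsHypothesis.…` repeats a component by the D-0017 layout
-- (single-conjunct summit), which the `dupNamespace` linter flags; the name is mandated.
set_option linter.dupNamespace false

namespace Summit.ValiantsHypothesis.ValiantsHypothesis.Theorems.KPlusLogSqLaw.TowerGraft

open Polynomial Complex
open scoped BigOperators Polynomial Real

/-! ## §1 The residual vanishes to order `m − 1` at a root of `A·E` of multiplicity `m` -/

section Multiplicity

/-- `(X − a)^(m−1) ∣ X(A′E − AE′) − D·AE` whenever `(X − a)^μ ∣ A`, `(X − a)^ν ∣ E`, `μ + ν = m` (any commutative ring). [folklore] -/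
theorem pow_sub_one_dvd_residual {R : Type*} [CommRing R] (A E : R[X]) (d : R) (a : R) (μ ν : ℕ)
    (hA : (X - C a) ^ μ ∣ A) (hE : (X - C a) ^ ν ∣ E) :
    (X - C a) ^ (μ + ν - 1) ∣ X * (derivative A * E - A * derivative E) - C d * (A * E) := by
  have hA' : (X - C a) ^ (μ - 1) ∣ derivative A := pow_sub_one_dvd_derivative_of_pow_dvd hA
  have hE' : (X - C a) ^ (ν - 1) ∣ derivative E := pow_sub_one_dvd_derivative_of_pow_dvd hE
  have h1 : (X - C a) ^ (μ + ν - 1) ∣ derivative A * E := by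
    have h := mul_dvd_mul hA' hE
    rw [← pow_add] at h
    exact (pow_dvd_pow _ (by omega)).trans h
  have h2 : (X - C a) ^ (μ + ν - 1) ∣ A * derivative E := by
    have h := mul_dvd_mul hA hE'
    rw [← pow_add] at h
    exact (pow_dvd_pow _ (by omega)).trans h
  have h3 : (X - C a) ^ (μ + ν - 1) ∣ A * E := by
    have h := mul_dvd_mul hA hE
    rw [← pow_add] at h
    exact (pow_dvd_pow _ (by omega)).trans h
  exact dvd_sub (dvd_mul_of_dvd_right (dvd_sub h1 h2) _) (dvd_mul_of_dvd_right h3 _)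

/-- root multiplicities: `rootMultiplicity a (X(A′E − AE′) − D·AE) + 1 ≥ rootMultiplicity a (A·E)` over a field, when the residual is
non-zero. [folklore] -/
theorem rootMultiplicity_residual_ge {K : Type*} [Field K] (A E : K[X]) (d a : K) (hA : A ≠ 0) (hE : E ≠ 0)
    (hW : X * (derivative A * E - A * derivative E) - C d * (A * E) ≠ 0) :
    rootMultiplicity a (A * E) ≤ rootMultiplicity a (X * (derivative A * E - A * derivative E) - C d * (A * E)) + 1 := by
  rw [rootMultiplicity_mul (mul_ne_zero hA hE)]
  have h := pow_sub_one_dvd_residual A E d a (rootMultiplicity a A) (rootMultiplicity a E)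
    (pow_rootMultiplicity_dvd A a) (pow_rootMultiplicity_dvd E a)
  have h2 := (le_rootMultiplicity_iff hW).mpr h
  omega

end Multiplicity

/-! ## §2 Counting inside one disc: zeros of the residual off `A·E = 0` vs distinct roots of `A·E` (Rouché) -/

section OneDisc

/-- a finset of points, each a root of `P` in the disc with prescribed multiplicity lower bounds, is dominated by the root count of `P`
in the disc. [folklore] -/
theorem sum_le_card_roots_filter (P : ℂ[X]) (c : ℂ) (R : ℝ) (U : Finset ℂ) (f : ℂ → ℕ)
    (hU : ∀ x ∈ U, dist x c < R) (hf : ∀ x ∈ U, f x ≤ rootMultiplicity x P) :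
    ∑ x ∈ U, f x ≤ Multiset.card (P.roots.filter fun z => dist z c < R) := by
  classical
  set N := P.roots.filter fun z => dist z c < R with hN
  have hsub : (N.filter fun z => z ∈ U).toFinset ⊆ U := by
    intro x hx
    rw [Multiset.mem_toFinset, Multiset.mem_filter] at hx
    exact hx.2
  calc ∑ x ∈ U, f x ≤ ∑ x ∈ U, N.count x := by
        refine Finset.sum_le_sum fun x hx => ?_
        rw [hN, Multiset.count_filter_of_pos (p := fun z => dist z c < R) (hU x hx), count_roots]
        exact hf x hx
    _ = ∑ x ∈ U, (N.filter fun z => z ∈ U).count x :=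
        Finset.sum_congr rfl fun x hx => (Multiset.count_filter_of_pos (p := fun z => z ∈ U) hx).symm
    _ = ∑ x ∈ (N.filter fun z => z ∈ U).toFinset, (N.filter fun z => z ∈ U).count x :=
        (Finset.sum_subset hsub fun x _ hxnot =>
          Multiset.count_eq_zero.mpr fun h => hxnot (Multiset.mem_toFinset.mpr h)).symm
    _ = Multiset.card (N.filter fun z => z ∈ U) := Multiset.toFinset_sum_count_eq _
    _ ≤ Multiset.card N := Multiset.card_le_card (Multiset.filter_le _ N)

/-- **ONE-DISC COUNT.**  Let `A, E ∈ ℝ[X]` be non-zero and `W = X(A′E − AE′) − D·AE`.  If on the circle `|τ − c| = R` (`R > 0`) the complexified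
residual satisfies the Rouché inequality `‖W(τ) + D·A(τ)E(τ)‖ < ‖D·A(τ)E(τ)‖`, then the real zeros of `W` in the disc that are NOT roots of
`A·E` number at most the DISTINCT complex roots of `A·E` in the disc. [this work] -/
theorem card_real_zeros_residual_le_in_disc (A E : ℝ[X]) (D : ℕ) (hA : A ≠ 0) (hE : E ≠ 0) (c : ℂ) {R : ℝ} (hR : 0 < R)
    (hbd : ∀ τ ∈ Metric.sphere c R,
      ‖((X * (derivative A * E - A * derivative E) - C (D : ℝ) * (A * E)).map Complex.ofRealHom +
          C (D : ℂ) * ((A * E).map Complex.ofRealHom)).eval τ‖ <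
        ‖(C (D : ℂ) * ((A * E).map Complex.ofRealHom)).eval τ‖)
    (T : Finset ℝ) (hT : ∀ t ∈ T, dist (t : ℂ) c < R ∧ A.eval t ≠ 0 ∧ E.eval t ≠ 0 ∧
      (X * (derivative A * E - A * derivative E) - C (D : ℝ) * (A * E)).eval t = 0) :
    T.card ≤ (((A * E).map Complex.ofRealHom).roots.filter fun z => dist z c < R).toFinset.card := by
  classical
  set W : ℝ[X] := X * (derivative A * E - A * derivative E) - C (D : ℝ) * (A * E) with hW
  set Wc : ℂ[X] := W.map Complex.ofRealHom with hWc
  set Fc : ℂ[X] := (A * E).map Complex.ofRealHom with hFc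
  set Ac := A.map Complex.ofRealHom with hAc
  set Ec := E.map Complex.ofRealHom with hEc
  have hAc0 : Ac ≠ 0 := (Polynomial.map_ne_zero_iff Complex.ofRealHom.injective).mpr hA
  have hEc0 : Ec ≠ 0 := (Polynomial.map_ne_zero_iff Complex.ofRealHom.injective).mpr hE
  have hFc_eq : Fc = Ac * Ec := by rw [hFc, Polynomial.map_mul]
  have hFc0 : Fc ≠ 0 := by rw [hFc_eq]; exact mul_ne_zero hAc0 hEc0
  have hWc_eq : Wc = X * (derivative Ac * Ec - Ac * derivative Ec) - C (D : ℂ) * (Ac * Ec) := by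
    simp [hWc, hW, hAc, hEc, Polynomial.map_sub, Polynomial.map_mul, Polynomial.derivative_map]
  have hD0 : (D : ℂ) ≠ 0 := by
    intro hD
    obtain ⟨τ, hτ⟩ : (Metric.sphere c R).Nonempty := (NormedSpace.sphere_nonempty).mpr hR.le
    have := hbd τ hτ
    rw [hD, map_zero, zero_mul, add_zero, eval_zero, norm_zero] at this
    exact absurd this (not_lt.mpr (norm_nonneg _))
  -- Rouché against `−D·A·E`: root counts of `Wc` and `Fc` in the disc agree
  have hrouche := card_roots_filter_ball_eq_of_norm_lt (-(C (D : ℂ) * Fc)) (Wc + C (D : ℂ) * Fc) c hR (by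
    intro τ hτ
    rw [eval_neg, norm_neg]
    exact hbd τ hτ)
  rw [show -(C (D : ℂ) * Fc) + (Wc + C (D : ℂ) * Fc) = Wc by ring, Polynomial.roots_neg, roots_C_mul _ hD0] at hrouche
  have hWc0 : Wc ≠ 0 := by
    intro h0
    obtain ⟨τ, hτ⟩ : (Metric.sphere c R).Nonempty := (NormedSpace.sphere_nonempty).mpr hR.le
    have := hbd τ hτ
    rw [h0, zero_add] at this
    exact lt_irrefl _ this
  -- the distinct roots of `Fc` in the disc and the lifted real zeros
  set S := (Fc.roots.filter fun z => dist z c < R).toFinset with hS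
  set T' : Finset ℂ := T.image fun t : ℝ => (t : ℂ) with hT'
  have hT'card : T'.card = T.card := Finset.card_image_of_injective _ Complex.ofReal_injective
  have hev : ∀ (Q : ℝ[X]) (x : ℝ), (Q.map Complex.ofRealHom).eval (x : ℂ) = ((Q.eval x : ℝ) : ℂ) := fun Q x => by
    rw [Polynomial.eval_map, ← Complex.ofRealHom_eq_coe, Polynomial.eval₂_at_apply, Complex.ofRealHom_eq_coe]
  have hdisj : Disjoint S T' := by
    rw [Finset.disjoint_left]
    intro x hxS hxT
    rw [hT', Finset.mem_image] at hxT
    obtain ⟨t, ht, rfl⟩ := hxT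
    rw [hS, Multiset.mem_toFinset, Multiset.mem_filter, Polynomial.mem_roots hFc0, Polynomial.IsRoot.def, hFc, hev] at hxS
    have := hxS.1
    rw [Complex.ofReal_eq_zero, eval_mul] at this
    rcases mul_eq_zero.mp this with h | h
    · exact (hT t ht).2.1 h
    · exact (hT t ht).2.2.1 h
  -- multiplicity lower bounds on `S ∪ T'`
  set f : ℂ → ℕ := fun x => if x ∈ T' then 1 else rootMultiplicity x Fc - 1 with hf
  have hU : ∀ x ∈ S ∪ T', dist x c < R := by
    intro x hx
    rcases Finset.mem_union.mp hx with hx | hx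
    · rw [hS, Multiset.mem_toFinset, Multiset.mem_filter] at hx; exact hx.2
    · rw [hT', Finset.mem_image] at hx
      obtain ⟨t, ht, rfl⟩ := hx
      exact (hT t ht).1
  have hfle : ∀ x ∈ S ∪ T', f x ≤ rootMultiplicity x Wc := by
    intro x hx
    by_cases hxT : x ∈ T'
    · simp only [hf, if_pos hxT]
      rw [hT', Finset.mem_image] at hxT
      obtain ⟨t, ht, rfl⟩ := hxT
      refine (Polynomial.rootMultiplicity_pos hWc0).mpr ?_
      rw [Polynomial.IsRoot.def, hWc, hev, Complex.ofReal_eq_zero]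
      exact (hT t ht).2.2.2
    · simp only [hf, if_neg hxT]
      have h := rootMultiplicity_residual_ge Ac Ec (D : ℂ) x hAc0 hEc0 (by rw [← hWc_eq]; exact hWc0)
      rw [← hWc_eq, ← hFc_eq] at h
      omega
  have hsum := sum_le_card_roots_filter Wc c R (S ∪ T') f hU hfle
  rw [Finset.sum_union hdisj, hrouche] at hsum
  -- `Σ_S (m − 1) + |T'| ≤ Σ_S m`
  have hS1 : ∑ x ∈ S, f x = ∑ x ∈ S, (rootMultiplicity x Fc - 1) := by
    refine Finset.sum_congr rfl fun x hx => ?_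
    simp only [hf, if_neg (Finset.disjoint_left.mp hdisj hx)]
  have hT1 : ∑ x ∈ T', f x = T'.card := by
    rw [Finset.card_eq_sum_ones]
    refine Finset.sum_congr rfl fun x hx => ?_
    simp only [hf, if_pos hx]
  have hFsum : Multiset.card (Fc.roots.filter fun z => dist z c < R) = ∑ x ∈ S, rootMultiplicity x Fc := by
    rw [hS, ← Multiset.toFinset_sum_count_eq]
    refine Finset.sum_congr rfl fun x hx => ?_
    rw [Multiset.mem_toFinset, Multiset.mem_filter] at hx
    rw [Multiset.count_filter_of_pos (p := fun z => dist z c < R) hx.2, count_roots]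
  have hmpos : ∀ x ∈ S, 1 ≤ rootMultiplicity x Fc := by
    intro x hx
    rw [hS, Multiset.mem_toFinset, Multiset.mem_filter, Polynomial.mem_roots hFc0] at hx
    exact Nat.one_le_iff_ne_zero.mpr ((Polynomial.rootMultiplicity_pos hFc0).mpr hx.1).ne'
  rw [hS1, hT1, hFsum] at hsum
  have hsub : ∑ x ∈ S, (rootMultiplicity x Fc - 1) + S.card = ∑ x ∈ S, rootMultiplicity x Fc := by
    rw [Finset.card_eq_sum_ones, ← Finset.sum_add_distrib]
    exact Finset.sum_congr rfl fun x hx => Nat.sub_add_cancel (hmpos x hx)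
  rw [← hT'card]
  omega

end OneDisc


end Summit.ValiantsHypothesis.ValiantsHypothesis.Theorems.KPlusLogSqLaw.TowerGraft
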